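import Summits.AtomisticToContinuum.HydrodynamicLimit.Theorems.CollisionIsometryCLTAdaptedWeightCLTLine

/-!
# Statements of the line `contact-source-duhamel` for the crux `AdaptedWeightCLT`
(stmt-AtomisticToContinuum-12949; route `CollisionIsometryCLT`, sub-problem `HydrodynamicLimit`)

Second half of the line's vocabulary (`--supports stmt-AtomisticToContinuum-12949`; the objects live in
`CollisionIsometryCLTAdaptedWeightCLTLine.lean`): the predicates the seven registered stubs prove or
consume, verbatim from the registered skeleton `Cruxes/AdaptedWeightCLT/Lines/contact-source-duhamel.lean`
— `NiceProfiles`, `AdmissibleKernel`, `DuhamelIdentity` [stub 1], `FlowDictionary` [stub 2], `DiffuseAt`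
(H1 = the conclusion of `DiffuseBackwardInfluence` at `(σ, Φ)`, verbatim), `TailsAt` (H2 = `AprioriBounds`
(i), verbatim), `CruxTail` (the crux's conclusion from `∀ (γ C : ℝ) (φ …)` on, verbatim), `CDAlongAt`,
`PastSmallAt`, `CrossNullAt`, `SourceContractionAt`. Nothing is asserted: every `def … : Prop` is a
predicate, never a hypothesis taken as a fact. `adaptedWeightCLTRev11_iff` (deprecated alias
`adaptedWeightCLT_iff`) records by `Iff.rfl` that the rev-11 crux (stmt-12949, recorded verbatim as
`AdaptedWeightCLTRev11` after route rev 12 restated `AdaptedWeightCLT` time-locally under the same name, 2026-08-16)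
IS `∀ nice profiles ∃ σ₀ ∀ σ < σ₀ ∀ Φ, DiffuseAt → TailsAt → CruxTail` in this vocabulary.
-/

namespace Summit.AtomisticToContinuum.HydrodynamicLimit.Theorems.ContactSourceDuhamel

open scoped BigOperators Topology Classical MeasureTheory ENNReal InnerProductSpace
open Filter Set MeasureTheory

noncomputable section

/-! ## The statements of the line -/

/-- Continuous, positive profiles (the crux's hypotheses on `a₀, θ₀, u₀`). -/
def NiceProfiles (a₀ θ₀ : T3 → ℝ) (u₀ : T3 → V3) : Prop :=
  Continuous a₀ ∧ Continuous θ₀ ∧ Continuous u₀ ∧ (∀ x, 0 < a₀ x) ∧ (∀ x, 0 < θ₀ x)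

/-- Admissible kernel families (verbatim the crux's kernel hypothesis at `(γ, C, φ)`). -/
def AdmissibleKernel (γ C : ℝ) (φ : ℕ → T3 → ℝ) : Prop :=
  (∀ N, Literature.Analysis.FunctionSpaces.Torus.IsSmooth (φ N)) ∧ (∀ N y, 0 ≤ φ N y) ∧ (∀ N, ∫ y, φ N y = 1) ∧ (∀ (N : ℕ) y, ((N : ℝ) + 1) ^ (-γ) ≤ Literature.Analysis.FluidPDE.Torus.euclidDist y 0 → φ N y = 0) ∧ (∀ (N : ℕ) y, φ N y ≤ C * ((N : ℝ) + 1) ^ (3 * γ)) ∧ (∀ (N : ℕ) y, ‖Literature.Analysis.FunctionSpaces.Torus.gradient (φ N) y‖ ≤ C * ((N : ℝ) + 1) ^ (4 * γ))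

/-- **VARIATION OF CONSTANTS along the collision sequence** (exact algebra of the typed fold, all
ranks `r ≥ 1`; at `r = 0` the binomial split `1 = 1 + 1` is false, at `r = 1` there are no sources —
momentum conservation): for every `N`, window start `y`, shift `u` and number of fold steps `m`, the family of
rank-`r` powers of the shifted transported velocities equals the incoherent transport of the initial
powers plus the sum over the steps `l < m` of the sources of step `l` transported from step `l+1` on:
`Y^{(m)} = 𝒯_{0→m} Y^{(0)} + Σ_{l<m} 𝒯_{l+1→m} src_l`. -/
def DuhamelIdentity (σ : ℝ) : Prop :=
  ∀ (r N : ℕ) (y : Cfg N) (u : V3) (m : ℕ), 0 < r →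
    (fun i => tpow r (velAfter σ N y m i - u)) =
      tTransport r σ N y 0 m (fun k => tpow r ((y k).2 - u)) +
        ∑ l ∈ Finset.range m, tTransport r σ N y (l + 1) (m - (l + 1)) (src r σ N y u l)

/-- **FLOW DICTIONARY** (the fold IS the flow, almost surely and uniformly in time): for every `N`
and every hard-sphere flow of `N+1` spheres of diameter `hsDiameter σ N` on `𝕋³`, for Liouville-a.e.
`z`, for ALL `s` and `Δ ≥ 0`, the velocities of `Φ_{s+Δ} z` are the crux's transfer over `[0, Δ]`
restarted at `Φ_s z` applied to the velocities of `Φ_s z` (the uniform-in-`s` form of the route's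
support item `TransferRepresentsFlow`, stmt-12952). -/
def FlowDictionary (σ : ℝ) : Prop :=
  ∀ (N : ℕ) (Φ : Flow σ N),
    ∀ᵐ z ∂(Literature.Analysis.FluidPDE.liouville (Literature.Analysis.FluidPDE.Torus.geometry (Fin 3))
      (N + 1) (Literature.MathematicalPhysics.KineticTheory.hsDiameter σ N)),
      ∀ s Δ : ℝ, 0 ≤ Δ →
        (fun i => (Φ.flow (s + Δ) z i).2) = velAfter σ N (Φ.flow s z) (steps σ N (Φ.flow s z) Δ)

/-- H1 at `(σ, profiles, Φ)`: verbatim the crux's first hypothesis (= the conclusion of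
`DiffuseBackwardInfluence`), its `let M; let ipr` written as this file's `iprF`. -/
def DiffuseAt (σ : ℝ) (a₀ θ₀ : T3 → ℝ) (u₀ : T3 → V3) (Φ : Flows σ) : Prop :=
  ∀ Δ : ℕ → ℝ, (∀ N, 0 < Δ N) → Tendsto Δ atTop (𝓝 0) → Tendsto (fun N : ℕ => Δ N * ((N + 1 : ℕ) : ℝ) ^ ((1 : ℝ) / 3)) atTop atTop → ∀ t : ℝ, 0 < t → Tendsto (fun N : ℕ => ∫⁻ z, ENNReal.ofReal (iprF σ N ((Φ N).flow (t - Δ N) z) (Δ N)) ∂(Literature.MathematicalPhysics.KineticTheory.localGibbsLaw σ a₀ u₀ θ₀ N (Φ N))) atTop (𝓝 0)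

/-- H2 at `(σ, profiles, Φ)`: verbatim the crux's second hypothesis (= `AprioriBounds` (i)). -/
def TailsAt (σ : ℝ) (a₀ θ₀ : T3 → ℝ) (u₀ : T3 → V3) (Φ : Flows σ) : Prop :=
  ∀ t : ℝ, 0 < t → ∃ lam Cexp : ℝ, 0 < lam ∧ Tendsto (fun N : ℕ => Literature.MathematicalPhysics.KineticTheory.localGibbsLaw σ a₀ u₀ θ₀ N (Φ N) {z | Cexp < ∫ s in Icc 0 t, ∫ y, Real.exp (lam * ‖y.2‖ ^ 2) ∂(Literature.Analysis.FluidPDE.empiricalMeasure ((Φ N).flow s z))}) atTop (𝓝 0)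

/-- The conclusion of the crux at `(σ, profiles, Φ)`: verbatim its text from `∀ (γ C : ℝ) (φ …)` on
(the `let ρb mb ub D q` telescope included), so that the composition closes by `exact`. -/
def CruxTail (σ : ℝ) (a₀ θ₀ : T3 → ℝ) (u₀ : T3 → V3) (Φ : Flows σ) : Prop :=
  ∀ (γ C : ℝ) (φ : ℕ → (UnitAddTorus (Fin 3)) → ℝ), 0 < γ → γ ≤ 1 / 15 → ((∀ N, Literature.Analysis.FunctionSpaces.Torus.IsSmooth (φ N)) ∧ (∀ N y, 0 ≤ φ N y) ∧ (∀ N, ∫ y, φ N y = 1) ∧ (∀ (N : ℕ) y, ((N : ℝ) + 1) ^ (-γ) ≤ Literature.Analysis.FluidPDE.Torus.euclidDist y 0 → φ N y = 0) ∧ (∀ (N : ℕ) y, φ N y ≤ C * ((N : ℝ) + 1) ^ (3 * γ)) ∧ (∀ (N : ℕ) y, ‖Literature.Analysis.FunctionSpaces.Torus.gradient (φ N) y‖ ≤ C * ((N : ℝ) + 1) ^ (4 * γ))) → let ρb := fun (N : ℕ) (s : ℝ) z (x : UnitAddTorus (Fin 3)) => Literature.MathematicalPhysics.KineticTheory.empiricalDensityField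 ((Φ N).flow s z) (fun y => φ N (y - x)); let mb := fun (N : ℕ) (s : ℝ) z (x : UnitAddTorus (Fin 3)) => Literature.MathematicalPhysics.KineticTheory.empiricalMomentumField ((Φ N).flow s z) (fun y => φ N (y - x)); let ub := fun (N : ℕ) (s : ℝ) z (x : UnitAddTorus (Fin 3)) => (ρb N s z x)⁻¹ • mb N s z x; let D := fun (N : ℕ) (s : ℝ) z (x : UnitAddTorus (Fin 3)) (j k : Fin 3) => (∫ y, φ N (y.1 - x) * ((y.2 j - ub N s z x j) * (y.2 k - ub N s z x k)) ∂(Literature.Analysis.FluidPDE.empiricalMeasure ((Φ N).flow s z))) - (if j = k then (∑ l : Fin 3, ∫ y, φ N (y.1 - x) * (y.2 l - ub N s z x l) ^ 2 ∂(Literature.Analysis.FluidPDE.empiricalMeasure ((Φ N).flow s z))) / 3 else 0); let q := fun (N : ℕ) (s : ℝ) z (x : UnitAddTorus (Fin 3)) => ∫ y, (φ N (y.1 - x) * ‖y.2 - ub N s z x‖ ^ 2 / 2) • (y.2 - ub N s z x) ∂(Literature.Analysis.FluidPDE.empiricalMeasure ((Φ N).flow s z)); ∀ t : ℝ, 0 <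 t → ∀ δ : ℝ, 0 < δ → Tendsto (fun N : ℕ => Literature.MathematicalPhysics.KineticTheory.localGibbsLaw σ a₀ u₀ θ₀ N (Φ N) {z | δ < ∫ s in Icc 0 t, ∫ x, ((∑ j, ∑ k, D N s z x j k ^ 2) + ‖q N s z x‖ ^ 2)}) atTop (𝓝 0)

/-- COLUMN DEPOLARISATION ALONG THE LINE WINDOW at `(σ, profiles, Φ)`: for every `t > 0` the
local-Gibbs mean of `cd2 + cd3` of the incoherent transport over `[t − Δℓ_N, t]` tends to `0`
(rank 2: impulse-cloud stresses reach `|a|²𝟙/3`; rank 3: impulse-cloud cubic tensors vanish). -/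
def CDAlongAt (σ : ℝ) (a₀ θ₀ : T3 → ℝ) (u₀ : T3 → V3) (Φ : Flows σ) : Prop :=
  ∀ t : ℝ, 0 < t → Tendsto (fun N : ℕ => ∫⁻ z, ENNReal.ofReal
      (cd2 σ N ((Φ N).flow (t - Δℓ N) z) (Δℓ N) + cd3 σ N ((Φ N).flow (t - Δℓ N) z) (Δℓ N))
    ∂(Literature.MathematicalPhysics.KineticTheory.localGibbsLaw σ a₀ u₀ θ₀ N (Φ N))) atTop (𝓝 0)

/-- PAST DAMPED at `(σ, profiles, Φ)`: for every admissible kernel family, `t > 0`, `δ > 0`,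
`P(∫₀ᵗ ∫ₓ Σ_tests PAST² > δ) → 0`. -/
def PastSmallAt (σ : ℝ) (a₀ θ₀ : T3 → ℝ) (u₀ : T3 → V3) (Φ : Flows σ) : Prop :=
  ∀ (γ C : ℝ) (φ : ℕ → T3 → ℝ), 0 < γ → γ ≤ 1 / 15 → AdmissibleKernel γ C φ →
    ∀ t : ℝ, 0 < t → ∀ δ : ℝ, 0 < δ →
      Tendsto (fun N : ℕ => Literature.MathematicalPhysics.KineticTheory.localGibbsLaw σ a₀ u₀ θ₀ N (Φ N)
        {z | δ < ∫ s in Icc 0 t, ∫ x, PastSq σ N (Φ N) φ s z x}) atTop (𝓝 0)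

/-- CONTACT CROSS NULL (CCN) at `(σ, profiles, Φ)`: for every admissible kernel family, `t > 0`,
`δ > 0`, `P(∫₀ᵗ ∫ₓ Σ_tests (Ξ − Ξ^ch)² > δ) → 0`. -/
def CrossNullAt (σ : ℝ) (a₀ θ₀ : T3 → ℝ) (u₀ : T3 → V3) (Φ : Flows σ) : Prop :=
  ∀ (γ C : ℝ) (φ : ℕ → T3 → ℝ), 0 < γ → γ ≤ 1 / 15 → AdmissibleKernel γ C φ →
    ∀ t : ℝ, 0 < t → ∀ δ : ℝ, 0 < δ →
      Tendsto (fun N : ℕ => Literature.MathematicalPhysics.KineticTheory.localGibbsLaw σ a₀ u₀ θ₀ N (Φ N)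
        {z | δ < ∫ s in Icc 0 t, ∫ x, XiDevSq σ N (Φ N) φ s z x}) atTop (𝓝 0)

/-- SOURCE CONTRACTION (the closure statement, signed form) at `(σ, profiles, Φ)`: for every
admissible kernel family and `t > 0` there is `κ < 1` such that for every `δ > 0`,
`P(∫₀ᵗ ∫ₓ Σ_tests Blk · Ξ^ch > κ ∫₀ᵗ ∫ₓ (|D|² + |q|²) + δ) → 0` — the chaos value of the source
sums, correlated with the current block stress / heat flux, never exceeds a fraction `κ < 1` of the
visible flux defect (predicted value `κ ≈ −1/2`: a restoring force). -/
def SourceContractionAt (σ : ℝ) (a₀ θ₀ : T3 → ℝ) (u₀ : T3 → V3) (Φ : Flows σ) : Prop :=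
  ∀ (γ C : ℝ) (φ : ℕ → T3 → ℝ), 0 < γ → γ ≤ 1 / 15 → AdmissibleKernel γ C φ →
    ∀ t : ℝ, 0 < t → ∃ κ : ℝ, κ < 1 ∧ ∀ δ : ℝ, 0 < δ →
      Tendsto (fun N : ℕ => Literature.MathematicalPhysics.KineticTheory.localGibbsLaw σ a₀ u₀ θ₀ N (Φ N)
        {z | κ * (∫ s in Icc 0 t, ∫ x, DefectSq σ N (Φ N) φ s z x) + δ <
          ∫ s in Icc 0 t, ∫ x, XiCorr σ N (Φ N) φ s z x}) atTop (𝓝 0)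


/-! ## The crux in this vocabulary -/

/-- **Record of the replaced route item `AdaptedWeightCLT`, rev 11** = stmt-AtomisticToContinuum-12949 (ledger
signature verbatim, elaborated under the route file's `open` context; NOT a route item): the crux whose vocabulary
this file spells out. Route rev 12 (2026-08-16T06:37Z) RESTATED the crux time-locally under the SAME decl name
`Theses.CollisionIsometryCLT.AdaptedWeightCLT` (now stmt-AtomisticToContinuum-14868) and retired stmt-12949, so the
rev-11 sanity lemma `adaptedWeightCLT_iff := Iff.rfl` stopped holding ("Type mismatch" in the full builds of
2026-08-16). The rev-11 statement is re-declared here under a Theorems-local name solely so that this append-only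
vocabulary file keeps elaborating; its eleven predicates are unchanged byte-for-byte (the time-local line re-uses
them through the `…TimeLocal` / `TL*` modules). Nothing is asserted. -/
def AdaptedWeightCLTRev11 : Prop :=
  open scoped Manifold ProbabilityTheory Matrix ComplexConjugate ContinuousMap in
  open Function TopologicalSpace in
  ∀ (a₀ θ₀ : (UnitAddTorus (Fin 3)) → ℝ) (u₀ : (UnitAddTorus (Fin 3)) → (EuclideanSpace ℝ (Fin 3))), Continuous a₀ → Continuous θ₀ → Continuous u₀ → (∀ x, 0 < a₀ x) → (∀ x, 0 < θ₀ x) → ∃ σ₀ : ℝ, 0 < σ₀ ∧ ∀ σ : ℝ, 0 < σ → σ < σ₀ → let M := fun (N : ℕ) (y : Literature.Analysis.FluidPDE.Config (N + 1) (Fin 3) (UnitAddTorus (Fin 3))) (Δ : ℝ) (W : Fin (N + 1) → EuclideanSpace ℝ (Fin 3)) => (let G := Literature.Analysis.FluidPDE.Torus.geometry (Fin 3); let ε : ℝ := Literature.MathematicalPhysics.KineticTheory.hsDiameter σ N; let pre := fun k : ℕ => (let zk := Literature.Analysis.FluidPDE.Alexander.stateAfter G ε y k; Literature.Analysis.FluidPDE.freeFlight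 G (Literature.Analysis.FluidPDE.Alexander.freeExitTime G ε zk).toReal zk); (List.range (Literature.Analysis.FluidPDE.Alexander.collisionCount G ε y Δ)).foldl (fun W' k => @dite (Fin (N + 1) → EuclideanSpace ℝ (Fin 3)) (Literature.Analysis.FluidPDE.Alexander.incomingPairs G ε (pre k)).Nonempty (Classical.propDecidable _) (fun h => fun i => (Literature.Analysis.FluidPDE.collidePair G h.some.1 h.some.2 (fun j => ((pre k j).1, W' j)) i).2) (fun _ => W')) W); let ipr := fun N y Δ => ((N + 1 : ℕ) : ℝ)⁻¹ * ∑ i : Fin (N + 1), ∑ k : Fin (N + 1), (∑ a : Fin 3, ‖M N y Δ (Pi.single k (EuclideanSpace.single a (1 : ℝ))) i‖ ^ 2) ^ 2; ∀ Φ : (N : ℕ) → Literature.Analysis.FluidPDE.HardSphereFlow (Literature.Analysis.FluidPDE.Torus.geometry (Fin 3)) (Literature.MathematicalPhysics.KineticTheory.hsDiameter σ N) (N + 1), (∀ Δ : ℕ → ℝ, (∀ N, 0 < Δ N) → Tendsto Δ atTop (𝓝 0) → Tendsto (fun N : ℕ => Δ N * ((N + 1 : ℕ) : ℝ) ^ ((1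 : ℝ) / 3)) atTop atTop → ∀ t : ℝ, 0 < t → Tendsto (fun N : ℕ => ∫⁻ z, ENNReal.ofReal (ipr N ((Φ N).flow (t - Δ N) z) (Δ N)) ∂(Literature.MathematicalPhysics.KineticTheory.localGibbsLaw σ a₀ u₀ θ₀ N (Φ N))) atTop (𝓝 0)) → (∀ t : ℝ, 0 < t → ∃ lam Cexp : ℝ, 0 < lam ∧ Tendsto (fun N : ℕ => Literature.MathematicalPhysics.KineticTheory.localGibbsLaw σ a₀ u₀ θ₀ N (Φ N) {z | Cexp < ∫ s in Icc 0 t, ∫ y, Real.exp (lam * ‖y.2‖ ^ 2) ∂(Literature.Analysis.FluidPDE.empiricalMeasure ((Φ N).flow s z))}) atTop (𝓝 0)) → ∀ (γ C : ℝ) (φ : ℕ → (UnitAddTorus (Fin 3)) → ℝ), 0 < γ → γ ≤ 1 / 15 → ((∀ N, Literature.Analysis.FunctionSpaces.Torus.IsSmooth (φ N)) ∧ (∀ N y, 0 ≤ φ N y) ∧ (∀ N, ∫ y, φ N y = 1) ∧ (∀ (N : ℕ) y, ((N : ℝ) + 1) ^ (-γ) ≤ Literature.Analysis.FluidPDE.Torus.euclidDist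 y 0 → φ N y = 0) ∧ (∀ (N : ℕ) y, φ N y ≤ C * ((N : ℝ) + 1) ^ (3 * γ)) ∧ (∀ (N : ℕ) y, ‖Literature.Analysis.FunctionSpaces.Torus.gradient (φ N) y‖ ≤ C * ((N : ℝ) + 1) ^ (4 * γ))) → let ρb := fun (N : ℕ) (s : ℝ) z (x : UnitAddTorus (Fin 3)) => Literature.MathematicalPhysics.KineticTheory.empiricalDensityField ((Φ N).flow s z) (fun y => φ N (y - x)); let mb := fun (N : ℕ) (s : ℝ) z (x : UnitAddTorus (Fin 3)) => Literature.MathematicalPhysics.KineticTheory.empiricalMomentumField ((Φ N).flow s z) (fun y => φ N (y - x)); let ub := fun (N : ℕ) (s : ℝ) z (x : UnitAddTorus (Fin 3)) => (ρb N s z x)⁻¹ • mb N s z x; let D := fun (N : ℕ) (s : ℝ) z (x : UnitAddTorus (Fin 3)) (j k : Fin 3) => (∫ y, φ N (y.1 - x) * ((y.2 j - ub N s z x j) * (y.2 k - ub N s z x k)) ∂(Literature.Analysis.FluidPDE.empiricalMeasure ((Φ N).flow s z))) - (if j = k then (∑ l : Fin 3, ∫ y, φ N (y.1 - x) * (y.2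 l - ub N s z x l) ^ 2 ∂(Literature.Analysis.FluidPDE.empiricalMeasure ((Φ N).flow s z))) / 3 else 0); let q := fun (N : ℕ) (s : ℝ) z (x : UnitAddTorus (Fin 3)) => ∫ y, (φ N (y.1 - x) * ‖y.2 - ub N s z x‖ ^ 2 / 2) • (y.2 - ub N s z x) ∂(Literature.Analysis.FluidPDE.empiricalMeasure ((Φ N).flow s z)); ∀ t : ℝ, 0 < t → ∀ δ : ℝ, 0 < δ → Tendsto (fun N : ℕ => Literature.MathematicalPhysics.KineticTheory.localGibbsLaw σ a₀ u₀ θ₀ N (Φ N) {z | δ < ∫ s in Icc 0 t, ∫ x, ((∑ j, ∑ k, D N s z x j k ^ 2) + ‖q N s z x‖ ^ 2)}) atTop (𝓝 0)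

/-- Sanity check of the verbatim copies against the rev-11 crux (`AdaptedWeightCLTRev11` =
stmt-AtomisticToContinuum-12949): it is, definitionally, `∀ nice profiles ∃ σ₀ ∀ σ < σ₀ ∀ Φ, DiffuseAt → TailsAt →
CruxTail` (its `let M; let ipr` ζδ-reduce to `transferSteps … (steps …)` / `iprF`, its conclusion is `CruxTail`
verbatim). -/
theorem adaptedWeightCLTRev11_iff :
    AdaptedWeightCLTRev11 ↔
      ∀ (a₀ θ₀ : T3 → ℝ) (u₀ : T3 → V3), Continuous a₀ → Continuous θ₀ → Continuous u₀ →
        (∀ x, 0 < a₀ x) → (∀ x, 0 < θ₀ x) → ∃ σ₀ : ℝ, 0 < σ₀ ∧ ∀ σ : ℝ, 0 < σ → σ < σ₀ →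
          ∀ Φ : Flows σ, DiffuseAt σ a₀ θ₀ u₀ Φ → TailsAt σ a₀ θ₀ u₀ Φ → CruxTail σ a₀ θ₀ u₀ Φ :=
  Iff.rfl

/-- Deprecated spelling of `adaptedWeightCLTRev11_iff`: the original sanity lemma read
`Theses.CollisionIsometryCLT.AdaptedWeightCLT ↔ …` against the rev-11 crux (stmt-12949); since route rev 12 that decl
name carries the time-local restatement (stmt-14868), for which the `Iff.rfl` is false, so the lemma now targets the
verbatim record `AdaptedWeightCLTRev11` of the statement it was about. -/
@[deprecated adaptedWeightCLTRev11_iff (since := "2026-08-16")]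
alias adaptedWeightCLT_iff := adaptedWeightCLTRev11_iff

end

end Summit.AtomisticToContinuum.HydrodynamicLimit.Theorems.ContactSourceDuhamel
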